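import Literature.AnabelianGeometry.SemiGraphs.PSCSmoothProperShape
import Literature.AnabelianGeometry.SemiGraphs.ProSigmaCuspInertiaMalnormalHolds
import Literature.AnabelianGeometry.SemiGraphs.ProSigmaCompletionModels
import Literature.AnabelianGeometry.SemiGraphs.PSCGraphicConverseIncidence
import HarnessLib

/-!
# PSC data of smooth-curve shape (one vertex, no nodes, cusp groups = pro-`Σ` cusp inertia): [CombGC] Prop. 1.2 (i)(ii), Prop. 1.5 (i) hold

Mochizuki, *A combinatorial version of the Grothendieck conjecture* [CombGC] §1, Prop. 1.2 p. 8, Prop. 1.5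
p. 12 [cite: MochizukiCombGC2007, §1 pp.8-12].  A datum `G : PSCDatum Π` (`PSCFundamentalGroup.lean`,
abc-iut-L3-t4) has the SHAPE that Def. 1.1 extracts from a SMOOTH hyperbolic curve of type `(g, r)`
(one irreducible component, no nodes, `r` marked points) when its semi-graph has one vertex, no nodes and
`r` cusps, `Π_v = Π`, and — for a pro-`Σ` completion `ι : Γ_{g,r} → Π` of the punctured surface group —
the cuspidal subgroups are the closed cusp inertia subgroups `closure ι⟨c_i⟩` (hypotheses below; `Π`
profinite).  PROOF-ONLY file extending `PSCSmoothProperShape.lean` (the case `r = 0`) with the tree's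
PROVED input [SemiAnbd] Ex. 2.10 / [AbsAnab] Lem. 1.3.7 `proSigmaCuspInertiaMalnormal_holds` (cusp inertia
infinite, pairwise disjoint up to conjugacy, malnormal; hence commensurably terminal,
`cuspInertia_closure_isCommensurablyTerminal`):

* **Prop. 1.2 (i), edge-like case** (`edgeLikeOpenInterDeterminesEdge_of_smoothCurve`): conjugates of the
  cusp groups of DISTINCT cusps meet trivially, so their intersection is never open in the (infinite,
  compact) cusp group;
* **Prop. 1.2 (ii)** (`commensurablyTerminal_of_smoothCurve`): `C_Π(Π) = Π`, and every conjugate of a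
  cusp group is commensurably terminal;
* **Prop. 1.5 (i)** (`edgeLikeIncidence_of_vertGp_eq_top`, no anabelian input): with one vertex and
  `Π_v = Π` every edge-like (= cuspidal) subgroup lies in exactly one verticial subgroup;
* ORIGIN-LEVEL instance forms of the abc-iut FACT-LIST rows F-0459 (Prop. 1.2 (i)), F-0438 (Prop. 1.2
  (ii)), F-0440 (Prop. 1.5 (i)), F-0461 (Thm. 1.6 (iii), from `PSCSmoothProperShape.lean`) and F-0443
  (Prop. 1.5 (ii), by COMPOSITION with abc-iut-w4-d081's reduction
  `graphicIffEdgeLikeVerticialHolds_of_incidence` of Prop. 1.5 (ii) to Prop. 1.2 (i) + Prop. 1.5 (i) +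
  the branch link, vacuous without nodes) at every origin all of whose data are of smooth-curve shape,
  and `exists_smoothCurveOrigin_holds`: such an origin is INHABITED by the genuine data of the tripod
  `P¹ ∖ {0,1,∞}` (type `(0,3)`, `Π = F̂₂`) and of every smooth hyperbolic curve in characteristic 0
  (`Σ` = all primes, `ι` = the profinite completion).

These are instance forms at GENUINE anabelian data (the malnormality theorems are the content), upgrading
the smooth-proper (edgeless) instance forms of `PSCSmoothProperOrigin.lean`; still consistency evidence
for the typed schemata, not the printed theorems for all pointed stable curves.  No side is taken on
[IUTchIII] Cor. 3.12.
-/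

noncomputable section

namespace Literature.AnabelianGeometry.SemiGraphs

namespace PSCDatum

open scoped Pointwise
open Literature.GroupTheory.CombinatorialGroupTheory
open SemiGraphOfAnabelioids (IsProSigmaCompletion proSigmaCuspInertiaMalnormal_holds
  cuspInertia_closure_isCommensurablyTerminal)

universe u

variable {P : Type u} [Group P] [TopologicalSpace P] [IsTopologicalGroup P]

/-! ### Helpers: conjugates of closed / commensurably terminal subgroups -/

omit [TopologicalSpace P] [IsTopologicalGroup P] in
/-- `C_Π(Π) = Π`. [folklore] -/
private theorem commensurator_top'' : Subgroup.Commensurable.commensurator (⊤ : Subgroup P) = ⊤ :=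
  eq_top_iff.mpr fun g _ => by
    rw [Subgroup.Commensurable.commensurator_mem_iff, conjAct_smul_top]

/-- A conjugate of a closed subgroup is closed (private copy of w5-d183's `isClosed_conj_smul`).
[cite: MochizukiCombGC2007, Def 1.1(ii) p.6] -/
private theorem isClosed_conj_smul' {A : Subgroup P} (hA : IsClosed (A : Set P)) (γ : ConjAct P) :
    IsClosed ((γ • A : Subgroup P) : Set P) := by
  have h : ((γ • A : Subgroup P) : Set P) = (fun x : P => γ⁻¹ • x) ⁻¹' (A : Set P) := by
    ext x
    rw [SetLike.mem_coe, Subgroup.mem_pointwise_smul_iff_inv_smul_mem]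
    rfl
  rw [h]
  refine hA.preimage ?_
  simp only [ConjAct.smul_def]
  fun_prop

omit [TopologicalSpace P] [IsTopologicalGroup P] in
/-- Commensurable terminality is conjugation-invariant: `C(γAγ⁻¹) = γ C(A) γ⁻¹`, so `C(A) = A` gives
`C(γAγ⁻¹) = γAγ⁻¹`. [cite: MochizukiCombGC2007, §0 p.3] -/
private theorem commensurator_smul_eq_of_eq {A : Subgroup P}
    (hA : Subgroup.Commensurable.commensurator A = A) (γ : ConjAct P) :
    Subgroup.Commensurable.commensurator (γ • A) = γ • A := by
  ext x
  rw [Subgroup.Commensurable.commensurator_mem_iff, Subgroup.mem_pointwise_smul_iff_inv_smul_mem,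
    ← mul_smul, Subgroup.Commensurable.commensurable_conj γ⁻¹, ← mul_smul, ← mul_smul,
    inv_mul_cancel, one_smul]
  have hx : γ⁻¹ * (ConjAct.toConjAct x * γ) = ConjAct.toConjAct (γ⁻¹ • x) := by
    simp [ConjAct.smul_def, mul_assoc]
  rw [hx, ← Subgroup.Commensurable.commensurator_mem_iff, hA]

/-! ### Prop. 1.5 (i) at one vertex with `Π_v = Π` and no nodes (any cusps; no anabelian input) -/

omit [IsTopologicalGroup P] in
/-- **Prop. 1.5 (i)** for a datum with one vertex carrying `Π_v = Π` and no nodes: every edge-like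
subgroup is cuspidal and lies in exactly one verticial subgroup, namely `Π`.
[cite: MochizukiCombGC2007, Prop 1.5(i) p.12] -/
theorem edgeLikeIncidence_of_vertGp_eq_top (G : PSCDatum P) [IsEmpty G.graph.N]
    (hV : ∀ v, G.vertGp v = ⊤) (v₀ : G.graph.V) : G.EdgeLikeIncidence := by
  intro E hE
  have hc : G.IsCuspidal E := hE.resolve_left (G.not_isNodal_of_isEmpty E)
  refine ⟨⟨fun _ => ⟨⊤, ⟨(G.isVerticial_iff_eq_top_of_vertGp_eq_top hV v₀ ⊤).mpr rfl, le_top⟩,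
    fun A hA => (G.isVerticial_iff_eq_top_of_vertGp_eq_top hV v₀ A).mp hA.1⟩, fun _ => hc⟩,
    ⟨fun h => absurd hc h, ?_⟩⟩
  rintro ⟨A₁, A₂, hne, hA⟩
  have h₁ := (G.isVerticial_iff_eq_top_of_vertGp_eq_top hV v₀ A₁).mp ((hA A₁).mpr (Or.inl rfl)).1
  have h₂ := (G.isVerticial_iff_eq_top_of_vertGp_eq_top hV v₀ A₂).mp ((hA A₂).mpr (Or.inr rfl)).1
  exact absurd (h₁.trans h₂.symm) hne

/-! ### Data of smooth-curve shape over a pro-`Σ` completion of `Γ_{g,r}` -/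

section SmoothCurve

variable [CompactSpace P] [T2Space P] [TotallyDisconnectedSpace P]
variable {Sigma : Set ℕ} {g r : ℕ}

/-- Conjugates of the cusp groups of DISTINCT cusps meet trivially ([SemiAnbd] Ex. 2.10 /
[AbsAnab] Lem. 1.3.7, proved in the tree). [cite: MochizukiCombGC2007, Prop 1.2(i) p.8] -/
theorem smul_cuspGp_inf_smul_cuspGp_eq_bot (hne : Sigma.Nonempty) (hprime : ∀ p ∈ Sigma, p.Prime)
    (h : PuncturedSurfaceGroup.IsHyperbolicType g r) (ι : PuncturedSurfaceGroup g r →* P)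
    (hι : IsProSigmaCompletion Sigma ι) (G : PSCDatum P) (e : G.graph.C ≃ Fin r)
    (hC : ∀ c, G.cuspGp c =
      ((PuncturedSurfaceGroup.cuspInertia (g := g) (e c)).map ι).topologicalClosure) {c₁ c₂ : G.graph.C} (hc : c₁ ≠ c₂)
    (γ₁ γ₂ : ConjAct P) :
    γ₁ • G.cuspGp c₁ ⊓ γ₂ • G.cuspGp c₂ = ⊥ := by
  have hij : e c₁ ≠ e c₂ := fun h' => hc (e.injective h')
  have hfact := (proSigmaCuspInertiaMalnormal_holds Sigma hne hprime g r h P ι hι (e c₁) (e c₂)).2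
    (ConjAct.ofConjAct (γ₁⁻¹ * γ₂)) (Or.inl hij)
  rw [ConjAct.toConjAct_ofConjAct, ← hC, ← hC] at hfact
  have := congrArg (fun X : Subgroup P => γ₁ • X) hfact
  simpa only [Subgroup.smul_inf, ← mul_smul, mul_inv_cancel_left, Subgroup.smul_bot] using this

/-- The cusp groups are infinite. [cite: MochizukiCombGC2007, Rmk 1.1.3 p.7] -/
theorem infinite_cuspGp (hne : Sigma.Nonempty) (hprime : ∀ p ∈ Sigma, p.Prime)
    (h : PuncturedSurfaceGroup.IsHyperbolicType g r) (ι : PuncturedSurfaceGroup g r →* P)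
    (hι : IsProSigmaCompletion Sigma ι) (G : PSCDatum P) (e : G.graph.C ≃ Fin r)
    (hC : ∀ c, G.cuspGp c =
      ((PuncturedSurfaceGroup.cuspInertia (g := g) (e c)).map ι).topologicalClosure) (c : G.graph.C) :
    Infinite (G.cuspGp c) := by
  rw [hC]
  exact (proSigmaCuspInertiaMalnormal_holds Sigma hne hprime g r h P ι hι (e c) (e c)).1

/-- **Prop. 1.2 (i), edge-like case, at smooth-curve shape**: if `A₁ ∩ A₂` is open in `A₁` for
conjugates `Aᵢ` of the cusp groups of `cᵢ`, then `c₁ = c₂` — otherwise `A₁ ∩ A₂ = 1` would be open in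
the infinite compact group `A₁`. [cite: MochizukiCombGC2007, Prop 1.2(i) p.8] -/
theorem edgeLikeOpenInterDeterminesEdge_of_smoothCurve (hne : Sigma.Nonempty) (hprime : ∀ p ∈ Sigma, p.Prime)
    (h : PuncturedSurfaceGroup.IsHyperbolicType g r) (ι : PuncturedSurfaceGroup g r →* P)
    (hι : IsProSigmaCompletion Sigma ι) (G : PSCDatum P) (e : G.graph.C ≃ Fin r)
    (hC : ∀ c, G.cuspGp c =
      ((PuncturedSurfaceGroup.cuspInertia (g := g) (e c)).map ι).topologicalClosure) [IsEmpty G.graph.N] :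
    G.EdgeLikeOpenInterDeterminesEdge := by
  intro e₁ e₂ γ₁ γ₂ hopen
  rcases e₁ with n | c₁
  · exact isEmptyElim n
  rcases e₂ with n | c₂
  · exact isEmptyElim n
  by_contra hne12
  have hc : c₁ ≠ c₂ := fun h' => hne12 (by rw [h'])
  change IsOpen ((((γ₁ • G.cuspGp c₁) ⊓ (γ₂ • G.cuspGp c₂)).subgroupOf (γ₁ • G.cuspGp c₁) :
    Subgroup (γ₁ • G.cuspGp c₁ : Subgroup P)) : Set (γ₁ • G.cuspGp c₁ : Subgroup P)) at hopen
  rw [G.smul_cuspGp_inf_smul_cuspGp_eq_bot hne hprime h ι hι e hC hc, Subgroup.bot_subgroupOf,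
    Subgroup.coe_bot] at hopen
  haveI : DiscreteTopology (γ₁ • G.cuspGp c₁ : Subgroup P) :=
    discreteTopology_iff_isOpen_singleton_one.mpr hopen
  haveI : CompactSpace (γ₁ • G.cuspGp c₁ : Subgroup P) :=
    isCompact_iff_compactSpace.mp (isClosed_conj_smul' (G.isClosed_cuspGp c₁) γ₁).isCompact
  haveI := G.infinite_cuspGp hne hprime h ι hι e hC c₁
  haveI : Infinite (γ₁ • G.cuspGp c₁ : Subgroup P) :=
    Infinite.of_injective _ (Subgroup.equivSMul γ₁ (G.cuspGp c₁)).injective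
  exact (‹Infinite (γ₁ • G.cuspGp c₁ : Subgroup P)›).not_finite finite_of_compact_of_discrete

/-- **Prop. 1.2 (i)** (all three cases) at smooth-curve shape with one vertex.
[cite: MochizukiCombGC2007, Prop 1.2(i) p.8] -/
theorem openInterDeterminesComponent_of_smoothCurve (hne : Sigma.Nonempty) (hprime : ∀ p ∈ Sigma, p.Prime)
    (h : PuncturedSurfaceGroup.IsHyperbolicType g r) (ι : PuncturedSurfaceGroup g r →* P)
    (hι : IsProSigmaCompletion Sigma ι) (G : PSCDatum P) (e : G.graph.C ≃ Fin r)
    (hC : ∀ c, G.cuspGp c =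
      ((PuncturedSurfaceGroup.cuspInertia (g := g) (e c)).map ι).topologicalClosure) [IsEmpty G.graph.N]
    (v₀ : G.graph.V) (hv : ∀ w, w = v₀) :
    G.VerticialOpenInterDeterminesVertex ∧ G.EdgeLikeOpenInterDeterminesEdge ∧
      G.UnrVerticialOpenInterDeterminesVertex :=
  ⟨G.verticialOpenInterDeterminesVertex_of_subsingleton v₀ hv,
    G.edgeLikeOpenInterDeterminesEdge_of_smoothCurve hne hprime h ι hι e hC,
    G.unrVerticialOpenInterDeterminesVertex_of_subsingleton v₀ hv⟩

/-- **Prop. 1.2 (ii) at smooth-curve shape**: `Π_v = Π` is commensurably terminal, and so is every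
conjugate of a cusp group (malnormal and infinite, [SemiAnbd] Ex. 2.10, proved in the tree); with one
vertex the unramified verticial subgroups are `Π`. [cite: MochizukiCombGC2007, Prop 1.2(ii) p.8] -/
theorem commensurablyTerminal_of_smoothCurve (hne : Sigma.Nonempty) (hprime : ∀ p ∈ Sigma, p.Prime)
    (h : PuncturedSurfaceGroup.IsHyperbolicType g r) (ι : PuncturedSurfaceGroup g r →* P)
    (hι : IsProSigmaCompletion Sigma ι) (G : PSCDatum P) (e : G.graph.C ≃ Fin r)
    (hC : ∀ c, G.cuspGp c =
      ((PuncturedSurfaceGroup.cuspInertia (g := g) (e c)).map ι).topologicalClosure) [IsEmpty G.graph.N]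
    (hV : ∀ v, G.vertGp v = ⊤) (v₀ : G.graph.V) :
    G.VerticialEdgeLikeCommensurablyTerminal ∧ G.UnrVerticialCommensurablyTerminal := by
  refine ⟨fun A hA => ?_, fun _ B hB => ?_⟩
  · rcases hA with hA | hA | hA
    · rw [(G.isVerticial_iff_eq_top_of_vertGp_eq_top hV v₀ A).mp hA]; exact commensurator_top''
    · exact absurd hA (G.not_isNodal_of_isEmpty A)
    · obtain ⟨c, γ, rfl⟩ := hA
      refine commensurator_smul_eq_of_eq ?_ γ
      rw [hC]
      exact (cuspInertia_closure_isCommensurablyTerminal hne hprime h ι hι (e c)).commensurator_eq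
  · obtain ⟨A, hA, rfl⟩ := hB
    rw [(G.isVerticial_iff_eq_top_of_vertGp_eq_top hV v₀ A).mp hA, top_sup_eq]
    exact commensurator_top''

end SmoothCurve

/-! ### Origin-level instance forms: origins of smooth-curve-shaped data -/

section Origin

variable (Ω : PSCOrigin.{u})

/-- **F-0459 / Prop. 1.2 (i)** at every origin whose data are of smooth-curve shape over pro-`Σ`
completions of punctured surface groups (profinite carriers). [cite: MochizukiCombGC2007, Prop 1.2(i) p.8] -/
theorem openInterDeterminesComponentHolds_of_smoothCurve
    (hΩ : ∀ ⦃Q : Type u⦄ [Group Q] [TopologicalSpace Q] [IsTopologicalGroup Q] (G : PSCDatum Q),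
      Ω.IsOfPSCType G → CompactSpace Q ∧ T2Space Q ∧ TotallyDisconnectedSpace Q ∧ IsEmpty G.graph.N ∧
        (∃ v₀ : G.graph.V, ∀ w, w = v₀) ∧
        ∃ (S : Set ℕ) (g r : ℕ) (ι : PuncturedSurfaceGroup g r →* Q) (e : G.graph.C ≃ Fin r),
          S.Nonempty ∧ (∀ p ∈ S, p.Prime) ∧ PuncturedSurfaceGroup.IsHyperbolicType g r ∧
          IsProSigmaCompletion S ι ∧
          ∀ c, G.cuspGp c = ((PuncturedSurfaceGroup.cuspInertia (g := g) (e c)).map ι).topologicalClosure) :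
    OpenInterDeterminesComponentHolds Ω := by
  intro Q _ _ _ G hG
  obtain ⟨_, _, _, _, ⟨v₀, hv⟩, S, g, r, ι, e, hne, hprime, h, hι, hC⟩ := hΩ G hG
  exact G.openInterDeterminesComponent_of_smoothCurve hne hprime h ι hι e hC v₀ hv

/-- **F-0438 / Prop. 1.2 (ii)** at every origin of smooth-curve-shaped data.
[cite: MochizukiCombGC2007, Prop 1.2(ii) p.8] -/
theorem commensurableTerminalityHolds_of_smoothCurve
    (hΩ : ∀ ⦃Q : Type u⦄ [Group Q] [TopologicalSpace Q] [IsTopologicalGroup Q] (G : PSCDatum Q),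
      Ω.IsOfPSCType G → CompactSpace Q ∧ T2Space Q ∧ TotallyDisconnectedSpace Q ∧ IsEmpty G.graph.N ∧
        (∀ v, G.vertGp v = ⊤) ∧ (∃ v₀ : G.graph.V, ∀ w, w = v₀) ∧
        ∃ (S : Set ℕ) (g r : ℕ) (ι : PuncturedSurfaceGroup g r →* Q) (e : G.graph.C ≃ Fin r),
          S.Nonempty ∧ (∀ p ∈ S, p.Prime) ∧ PuncturedSurfaceGroup.IsHyperbolicType g r ∧
          IsProSigmaCompletion S ι ∧
          ∀ c, G.cuspGp c = ((PuncturedSurfaceGroup.cuspInertia (g := g) (e c)).map ι).topologicalClosure) :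
    CommensurableTerminalityHolds Ω := by
  intro Q _ _ _ G hG
  obtain ⟨_, _, _, _, hV, ⟨v₀, -⟩, S, g, r, ι, e, hne, hprime, h, hι, hC⟩ := hΩ G hG
  exact G.commensurablyTerminal_of_smoothCurve hne hprime h ι hι e hC hV v₀

omit [IsTopologicalGroup P] in
/-- **F-0440 / Prop. 1.5 (i)** at every origin of one-vertex, node-free data with `Π_v = Π` (any cusps).
[cite: MochizukiCombGC2007, Prop 1.5(i) p.12] -/
theorem edgeLikeIncidenceHolds_of_vertGp_eq_top
    (hΩ : ∀ ⦃Q : Type u⦄ [Group Q] [TopologicalSpace Q] (G : PSCDatum Q), Ω.IsOfPSCType G →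
      IsEmpty G.graph.N ∧ (∀ v, G.vertGp v = ⊤) ∧ Nonempty G.graph.V) :
    EdgeLikeIncidenceHolds Ω := by
  intro Q _ _ G hG
  obtain ⟨_, hV, ⟨v₀⟩⟩ := hΩ G hG
  exact G.edgeLikeIncidence_of_vertGp_eq_top hV v₀

/-- **F-0461 / Thm. 1.6 (iii)** at every origin of one-vertex data with `Π_v = Π` (any edges): every `β`
is both verticially filtration-preserving and group-theoretically verticial
(`PSCSmoothProperShape.unrVerticiallyFiltrationPreservingIffVerticial_of_smoothProper` needs no edge
hypothesis). [cite: MochizukiCombGC2007, Thm 1.6(iii) p.13] -/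
theorem unrVerticialIffHolds_of_vertGp_eq_top
    (hΩ : ∀ ⦃Q : Type u⦄ [Group Q] [TopologicalSpace Q] (G : PSCDatum Q), Ω.IsOfPSCType G →
      (∀ v, G.vertGp v = ⊤) ∧ Nonempty G.graph.V) :
    UnrVerticialIffHolds Ω := by
  intro Q _ _ _ Q' _ _ _ G H β hG hH
  obtain ⟨hV, ⟨v₀⟩⟩ := hΩ G hG
  obtain ⟨hW, ⟨w₀⟩⟩ := hΩ H hH
  exact G.unrVerticiallyFiltrationPreservingIffVerticial_of_smoothProper H hV v₀ hW w₀ β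

/-- **F-0443 / Prop. 1.5 (ii)** at every origin of smooth-curve-shaped data, by COMPOSITION: Prop. 1.2 (i)
and Prop. 1.5 (i) hold there (above) and the branch link is vacuous (no nodes), so abc-iut-w4-d081's
reduction `graphicIffEdgeLikeVerticialHolds_of_incidence` applies — "graphic ⟺ group-theoretically
edge-like ∧ verticial" with a unique semi-graph isomorphism, for every `α` between two smooth-curve data.
[cite: MochizukiCombGC2007, Prop 1.5(ii) p.13] -/
theorem graphicIffEdgeLikeVerticialHolds_of_smoothCurve
    (hΩ : ∀ ⦃Q : Type u⦄ [Group Q] [TopologicalSpace Q] [IsTopologicalGroup Q] (G : PSCDatum Q),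
      Ω.IsOfPSCType G → CompactSpace Q ∧ T2Space Q ∧ TotallyDisconnectedSpace Q ∧ IsEmpty G.graph.N ∧
        (∀ v, G.vertGp v = ⊤) ∧ (∃ v₀ : G.graph.V, ∀ w, w = v₀) ∧
        ∃ (S : Set ℕ) (g r : ℕ) (ι : PuncturedSurfaceGroup g r →* Q) (e : G.graph.C ≃ Fin r),
          S.Nonempty ∧ (∀ p ∈ S, p.Prime) ∧ PuncturedSurfaceGroup.IsHyperbolicType g r ∧
          IsProSigmaCompletion S ι ∧
          ∀ c, G.cuspGp c = ((PuncturedSurfaceGroup.cuspInertia (g := g) (e c)).map ι).topologicalClosure)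
    (hΩ' : ∀ ⦃Q : Type u⦄ [Group Q] [TopologicalSpace Q] (G : PSCDatum Q), Ω.IsOfPSCType G →
      IsEmpty G.graph.N ∧ (∀ v, G.vertGp v = ⊤) ∧ Nonempty G.graph.V) :
    GraphicIffEdgeLikeVerticialHolds Ω :=
  graphicIffEdgeLikeVerticialHolds_of_incidence Ω
    (openInterDeterminesComponentHolds_of_smoothCurve Ω fun Q _ _ _ G hG => by
      obtain ⟨h1, h2, h3, h4, -, h6, h7⟩ := hΩ G hG
      exact ⟨h1, h2, h3, h4, h6, h7⟩)
    (edgeLikeIncidenceHolds_of_vertGp_eq_top Ω hΩ')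
    (fun Q _ _ _ G hG e => by
      obtain ⟨-, -, -, hN, -⟩ := hΩ G hG
      exact isEmptyElim e)

end Origin

/-! ### Inhabitation: the tripod and every smooth hyperbolic curve in characteristic 0 -/

/-- **The smooth-curve origin is inhabited by genuine data and satisfies F-0438 ∧ F-0459 ∧ F-0440 ∧
F-0461 ∧ F-0443.**  Let `Ω_sc` declare "of PSC-type" exactly the data of smooth-curve shape over profinite pro-`Σ`
completions of hyperbolic punctured surface groups (one vertex with `Π_v = Π`, no nodes, cusp groups the
closed cusp inertia groups).  Then Prop. 1.2 (i), Prop. 1.2 (ii), Prop. 1.5 (i) and Thm. 1.6 (iii) hold at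
`Ω_sc` (rows F-0459, F-0438, F-0440, F-0461), as does Prop. 1.5 (ii) (row F-0443, via abc-iut-w4-d081's
reduction), and `Ω_sc` contains the datum of the TRIPOD `P¹ ∖ {0,1,∞}`
in characteristic 0: type `(0,3)`, `Π = Γ̂_{0,3} = F̂₂` (Mathlib's profinite completion, `Σ` = all
primes, `ι = η` a pro-`Σ` completion by `isProSigmaCompletion_toCompletion`), three cusps with
`Π_{c_i} = closure η⟨c_i⟩`, genus 0.  Genuine anabelian content: the tree's malnormality theorems for cusp
inertia.  Consistency evidence for the typed schemata; not the printed theorems for all pointed stable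
curves. [cite: MochizukiCombGC2007, §1 pp.8-13] -/
theorem exists_smoothCurveOrigin_holds :
    ∃ Ω : PSCOrigin.{0},
      (∃ G : PSCDatum (Literature.IUT.HodgeTheaters.profiniteCompletion (PuncturedSurfaceGroup 0 3)),
        Ω.IsOfPSCType G ∧ G.Sigma = {p : ℕ | p.Prime} ∧ G.graph.i = 1 ∧ G.graph.n = 0 ∧ G.graph.r = 3 ∧
          (∀ v, G.vertGp v = ⊤ ∧ G.genus v = 0) ∧
          ∀ c, ∃ i : Fin 3, G.cuspGp c = ((PuncturedSurfaceGroup.cuspInertia (g := 0) i).map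
            (Literature.IUT.HodgeTheaters.toCompletion (PuncturedSurfaceGroup 0 3))).topologicalClosure) ∧
      CommensurableTerminalityHolds Ω ∧ OpenInterDeterminesComponentHolds Ω ∧
      EdgeLikeIncidenceHolds Ω ∧ UnrVerticialIffHolds Ω ∧ GraphicIffEdgeLikeVerticialHolds Ω := by
  let Ω : PSCOrigin.{0} :=
    ⟨fun {Q} _ _ G => ∃ (_ : IsTopologicalGroup Q), CompactSpace Q ∧ T2Space Q ∧
      TotallyDisconnectedSpace Q ∧ IsEmpty G.graph.N ∧ (∀ v, G.vertGp v = ⊤) ∧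
      (∃ v₀ : G.graph.V, ∀ w, w = v₀) ∧
      ∃ (S : Set ℕ) (g r : ℕ) (ι : PuncturedSurfaceGroup g r →* Q) (e : G.graph.C ≃ Fin r),
        S.Nonempty ∧ (∀ p ∈ S, p.Prime) ∧ PuncturedSurfaceGroup.IsHyperbolicType g r ∧
        IsProSigmaCompletion S ι ∧
        ∀ c, G.cuspGp c = ((PuncturedSurfaceGroup.cuspInertia (g := g) (e c)).map ι).topologicalClosure⟩
  -- the tripod datum
  let Γ := PuncturedSurfaceGroup 0 3
  let η := Literature.IUT.HodgeTheaters.toCompletion Γ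
  have hη : IsProSigmaCompletion {p : ℕ | p.Prime} η :=
    SemiGraphOfAnabelioids.IsProSigmaCompletion.isProSigmaCompletion_toCompletion Γ
  let T : PSCDatum (Literature.IUT.HodgeTheaters.profiniteCompletion Γ) :=
    { Sigma := {p | p.Prime}
      sigma_prime := fun _ hp => hp
      sigma_nonempty := ⟨2, Nat.prime_two⟩
      graph := { V := Unit, N := Empty, C := Fin 3, nodeEnds := Empty.elim, cuspEnd := fun _ => () }
      vertGp := fun _ => ⊤
      nodeGp := Empty.elim
      cuspGp := fun i => ((PuncturedSurfaceGroup.cuspInertia (g := 0) i).map η).topologicalClosure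
      genus := fun _ => 0
      isClosed_vertGp := fun _ => by rw [Subgroup.coe_top]; exact isClosed_univ
      isClosed_nodeGp := fun e => e.elim
      isClosed_cuspGp := fun _ => Subgroup.isClosed_topologicalClosure _
      nodeGp_le := fun e => e.elim
      cuspGp_le := fun _ => ⟨1, le_top⟩
      proSigma := ⟨fun _ _ _ hp _ => hp⟩ }
  have hT : Ω.IsOfPSCType T :=
    ⟨inferInstance, inferInstance, inferInstance, inferInstance, inferInstanceAs (IsEmpty Empty),
      fun _ => rfl, ⟨(), fun _ => rfl⟩, {p | p.Prime}, 0, 3, η, Equiv.refl _, ⟨2, Nat.prime_two⟩,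
      fun _ hp => hp, by unfold PuncturedSurfaceGroup.IsHyperbolicType; norm_num, hη, fun _ => rfl⟩
  refine ⟨Ω, ⟨T, hT, rfl, rfl, rfl, rfl, fun _ => ⟨rfl, rfl⟩, fun c => ⟨c, rfl⟩⟩, ?_, ?_, ?_, ?_, ?_⟩
  · refine commensurableTerminalityHolds_of_smoothCurve Ω fun Q _ _ _ G hG => ?_
    obtain ⟨_, h1, h2, h3, h4, h5, h6, h7⟩ := hG
    exact ⟨h1, h2, h3, h4, h5, h6, h7⟩
  · refine openInterDeterminesComponentHolds_of_smoothCurve Ω fun Q _ _ _ G hG => ?_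
    obtain ⟨_, h1, h2, h3, h4, -, h6, h7⟩ := hG
    exact ⟨h1, h2, h3, h4, h6, h7⟩
  · refine edgeLikeIncidenceHolds_of_vertGp_eq_top Ω fun Q _ _ G hG => ?_
    obtain ⟨_, -, -, -, h4, h5, ⟨v₀, -⟩, -⟩ := hG
    exact ⟨h4, h5, ⟨v₀⟩⟩
  · refine unrVerticialIffHolds_of_vertGp_eq_top Ω fun Q _ _ G hG => ?_
    obtain ⟨_, -, -, -, -, h5, ⟨v₀, -⟩, -⟩ := hG
    exact ⟨h5, ⟨v₀⟩⟩
  · refine graphicIffEdgeLikeVerticialHolds_of_smoothCurve Ω (fun Q _ _ _ G hG => ?_)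
      (fun Q _ _ G hG => ?_)
    · obtain ⟨_, h1, h2, h3, h4, h5, h6, h7⟩ := hG
      exact ⟨h1, h2, h3, h4, h5, h6, h7⟩
    · obtain ⟨_, -, -, -, h4, h5, ⟨v₀, -⟩, -⟩ := hG
      exact ⟨h4, h5, ⟨v₀⟩⟩

end PSCDatum

end Literature.AnabelianGeometry.SemiGraphs

end

-- build-queue re-enqueue (comment-only re-land by abc-iut-w4-d014 g7, 2026-08-26T10:4xZ): declarations byte-identical to the
-- accepted tree copy (sha16 184d06dd422112f2); purpose: produce the missing olean (stranded accept) so that PENDING children deferred «no-olean» can verify.
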